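import Summits.QuantumFields.BalabanUV.Beta.EriceRemainderEnclosureHistoryAutonomyComparisonAgeCompositionReadVariation

/-!
# EriceRemainderEnclosureHistoryAutonomyComparisonAgeCompositionHeatingCriterion — (E116a) route (N), first order, ABSTRACT: THE DIFFERENCED ROW IDENTITY
# AND THE HEATING CRITERION.  For a tail-sum kernel `K m l = Σ_{k∈(l,A)} w k m` (age `k` reads the lags `< k` at the rate `w k m` at the pin `m`) and a
# solution `v m = e m − R v m` of the triangular renewal system, differencing ONCE in the depth gives the EXACT identity (**`sol_step_eq`**,
# **`sol_step_eq_interior`**)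
#     `v m = (e m − e (m+1)) + (1 − F m)·v (m+1) + Σ_k w k (m+1)·v (m+1+κ_k) − Σ_k (w k m − w k (m+1))·Σ_{1 ≤ l < κ_k} v (m+1+l)`
# (`F m = Σ_k w k m` the first entry, `κ_k = min k N`): the value at the pin is the DROP OF THE EXCESS plus PERSISTENCE `(1 − F m)·v(m+1)` plus the
# OUTFLOW `Σ_k w k (m+1)·v(m+1+κ_k)` (the deepest value leaving each window) minus the HEATING — the DECAY of each rate from the row below to the pin,
# `w k m − w k (m+1) ≥ 0`, times the interior window sum.  A depth-INDEPENDENT kernel has no heating and positivity at any mass is read off ((E70c)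
# `renewal_nonneg`); along a flow the rates grow towards the pin and THE END AT THE ROW `m` IS EQUIVALENT TO «HEATING ≤ DROP + PERSISTENCE + OUTFLOW»
# (**`sol_nonneg_iff_heating_le`**).  Every term on the right is data of the rows BELOW the pin, so the END becomes a ROW INDUCTION whose only input
# is an upper bound for the interior window sums `Σ_{1≤l<k} v(m+1+l)` RELATIVE to `v(m+1)` — a HARNACK statement over each loaded window — against
# the rate decay (**`sol_nonneg_of_window_bounds`**, **`sol_nonneg_of_rowwise`**); the flow supplies the decay bound `w k m − w k (m+1) ≤
# (3∕4)·β_k(m+1)·Δa_{m+k+1}∕a_{m+k}²` with the BUDGETED share `β_k` ((E116b) `…HeatingCriterionFlow`), so that only windows spanning a doubling of the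
# level `a = 1∕h²` weigh (factor `r(1−r) ≤ 1∕4`, `r = a_{m+1}∕a_{m+k}`).  README `HOME/b2b-balaban-beta-d4-p2/g97/README.md` §2–§3 (numerics: on every
# admissible configuration computed the heating is ≤ 0.33 of persistence + outflow; the END's margin in this form is a factor ≥ 3).

Cell `pub-balaban`, β-function sub-cell, BINDER row D4 «RemainderConst leaves for Bałaban's split» (`HOME/BINDER-OWNERS.md`; owner lineage `b2b-balaban-beta-an4`;
this file by co-owner #2 lineage `b2b-balaban-beta-d4-p2`, generation 97), β-FLOW TEAM duty (1), FREEZE (0) honoured (def-free; imports (E115d) `…ReadVariation`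
and uses its `read_eq_sum_ages`, `window_succ` BY NAME; nothing restated; pure renewal algebra — no flow object enters).

HONEST FRAMING (page 1, verbatim and binding).  *"Discharging BetaPertH makes Bałaban's UV stability UNCONDITIONAL — a real constructive-QFT result; it is
NOT the continuum limit and NOT the Clay problem."*  THIS FILE DISCHARGES NOTHING OF THE KIND.  Elementary linear algebra about ABSTRACT real sequences and
triangular systems — tools for the cell's own first-order census (route (N) of conjecture (E58′)); the form, signs, ages and moments of Bałaban's (1.22) limit
functional are NOT PRINTED ([I] p. 298; GAPS G-t4-U2-1∕-2) and NOT asserted.  Row D4 class UNCHANGED (critical-path width 0; instance 0∕1; D4 DISCHARGE NO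
DATE).  HONEST DEPENDENCY: continuum YM on T⁴ ⇐ BetaPertH ∧ nine spine estimates (0/9 proved); BetaPertH ⇐ (D1) ∧ (D4) ∧ CAP+tail; G-an2-4 gates asym, D1
and NE2/3/4.

THE POINT (census sense (α); a route TRANSVERSE to the age induction of (E71a)∕(E115a–k)).  The age induction composes lone-age ENDs multiplicatively and
needs the RELATIVE regularity of multi-age old surpluses (README g96 §6 (1), open).  Here the induction runs over the ROWS only, all ages at once: the
identity isolates the single mechanism by which a renewal solution with non-increasing excess can turn negative — the kernel is heavier at the pin than one
row below — and prices it exactly: age `k` costs `(w k m − w k (m+1))·Σ_{1≤l<k} v(m+1+l)` and pays `w k (m+1)·v(m+1+k)`; the row as a whole has the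
credit `(1 − F m)·v(m+1) ≥ v(m+1)∕2`.  What the flow must supply (NOT done here): the size of the decay (a budget statement, (E116b)) and a Harnack bound
for `v` over the young windows below the pin relative to `v(m+1)` (README g97 §3: measured ≤ 1.36 over every level-doubling window on all admissible
configurations computed; the criterion tolerates ≈ 2.5).
NOT CLAIMED: any flow instance; any Harnack inequality; the END beyond the tree's classes; anything printed — NOT B12 Thm 2, NOT BetaPertH, NOT continuum,
NOT Clay.

WHAT IS PROVED ([folklore]; 0 `def`, 0 sorry; hypotheses display the reads `R`, the tail-sum kernel `K m l = Σ_{k∈Ico (l+1) A} w k m` and the solution as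
data, (E115d)'s conventions).  §1 **`sol_step_eq`** (full windows), `range_sum_eq_head_add_Ico`, **`sol_step_eq_interior`** (interior windows).  §2
**`sol_step_ge`**, **`sol_nonneg_iff_heating_le`**, **`sol_nonneg_of_window_bounds`**.  §3 **`sol_nonneg_of_rowwise`** (the row induction),
**`sol_le_input`**, **`sol_mem_Icc_of_rowwise`**.
-/
noncomputable section
open Finset

namespace Summit.QuantumFields.BalabanUV.Beta.EriceRemainderEnclosureHistoryAutonomyComparisonAgeCompositionHeatingCriterion

open Summit.QuantumFields.BalabanUV.Beta.EriceRemainderEnclosureHistoryAutonomyComparisonAgeCompositionReadVariation (read_eq_sum_ages window_succ)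

variable {A N : ℕ} {w : ℕ → ℕ → ℝ} {K : ℕ → ℕ → ℝ} {R : (ℕ → ℝ) → ℕ → ℝ}

/-! ## §1 The differenced row identity -/

/-- **THE DIFFERENCED ROW IDENTITY (full windows).**  Tail-sum kernel `K m l = Σ_{k∈(l,A)} w k m`, reads `R u m = Σ_{l<N} K m l·u(m+1+l)`, and ANY
sequence `v` with `v m = e m − R v m` at every depth (no sign, tail or monotonicity hypothesis).  Then, with `κ_k = min k N`,
`v m = (e m − e(m+1)) + (1 − Σ_k w k (m+1))·v(m+1) + Σ_k w k (m+1)·v(m+1+κ_k) − Σ_k (w k m − w k (m+1))·Σ_{l<κ_k} v(m+1+l)`: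
differencing the equations at `m` and `m+1`, each window shifted by one row loses its top value `v(m+1)` and gains the outflow value `v(m+1+κ_k)`
((E115d) `window_succ`). [folklore] -/
theorem sol_step_eq (hR : ∀ u m, R u m = ∑ l ∈ range N, K m l * u (m + 1 + l)) (hK : ∀ m l, K m l = ∑ k ∈ Ico (l + 1) A, w k m)
    {e v : ℕ → ℝ} (hrec : ∀ m, v m = e m - R v m) (m : ℕ) :
    v m = (e m - e (m + 1)) + (1 - ∑ k ∈ Ico 1 A, w k (m + 1)) * v (m + 1)
      + ∑ k ∈ Ico 1 A, w k (m + 1) * v (m + 1 + min k N)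
      - ∑ k ∈ Ico 1 A, (w k m - w k (m + 1)) * ∑ l ∈ range (min k N), v (m + 1 + l) := by
  have h0 := hrec m
  have h1 := hrec (m + 1)
  rw [read_eq_sum_ages hR hK v m] at h0
  rw [read_eq_sum_ages hR hK v (m + 1)] at h1
  have h2 : ∑ k ∈ Ico 1 A, w k (m + 1) * ∑ l ∈ range (min k N), v (m + 1 + 1 + l)
      = ∑ k ∈ Ico 1 A, w k (m + 1) * ∑ l ∈ range (min k N), v (m + 1 + l)
        + ∑ k ∈ Ico 1 A, w k (m + 1) * v (m + 1 + min k N) - (∑ k ∈ Ico 1 A, w k (m + 1)) * v (m + 1) := by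
    rw [sum_mul, ← sum_add_distrib, ← sum_sub_distrib]
    refine sum_congr rfl fun k _ => ?_
    rw [window_succ v m (min k N)]; ring
  rw [h2] at h1
  have h3 : ∑ k ∈ Ico 1 A, (w k m - w k (m + 1)) * ∑ l ∈ range (min k N), v (m + 1 + l)
      = ∑ k ∈ Ico 1 A, w k m * ∑ l ∈ range (min k N), v (m + 1 + l)
        - ∑ k ∈ Ico 1 A, w k (m + 1) * ∑ l ∈ range (min k N), v (m + 1 + l) := by
    rw [← sum_sub_distrib]; exact sum_congr rfl fun k _ => by ring
  rw [h3]; linarith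

/-- Splitting off the top value of a window: `Σ_{l<κ} u(m+1+l) = u(m+1) + Σ_{l∈[1,κ)} u(m+1+l)` for `κ ≥ 1`. [folklore] -/
theorem range_sum_eq_head_add_Ico (u : ℕ → ℝ) (m : ℕ) {κ : ℕ} (hκ : 1 ≤ κ) :
    ∑ l ∈ range κ, u (m + 1 + l) = u (m + 1) + ∑ l ∈ Ico 1 κ, u (m + 1 + l) := by
  rw [range_eq_Ico, sum_eq_sum_Ico_succ_bot (by omega : 0 < κ), add_zero]

/-- **THE DIFFERENCED ROW IDENTITY (interior windows).**  For `N ≥ 1` the top value of every window combines with the persistence term: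
`v m = (e m − e(m+1)) + (1 − F m)·v(m+1) + Σ_k w k (m+1)·v(m+1+κ_k) − Σ_k (w k m − w k (m+1))·Σ_{l∈[1,κ_k)} v(m+1+l)` with `F m = Σ_k w k m`
the FIRST ENTRY AT THE PIN: DROP OF THE EXCESS + PERSISTENCE + OUTFLOW − HEATING (the rate decay times the INTERIOR window sums). [folklore] -/
theorem sol_step_eq_interior (hR : ∀ u m, R u m = ∑ l ∈ range N, K m l * u (m + 1 + l)) (hK : ∀ m l, K m l = ∑ k ∈ Ico (l + 1) A, w k m)
    (hN : 1 ≤ N) {e v : ℕ → ℝ} (hrec : ∀ m, v m = e m - R v m) (m : ℕ) :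
    v m = (e m - e (m + 1)) + (1 - ∑ k ∈ Ico 1 A, w k m) * v (m + 1)
      + ∑ k ∈ Ico 1 A, w k (m + 1) * v (m + 1 + min k N)
      - ∑ k ∈ Ico 1 A, (w k m - w k (m + 1)) * ∑ l ∈ Ico 1 (min k N), v (m + 1 + l) := by
  have h := sol_step_eq hR hK hrec m
  have hsplit : ∑ k ∈ Ico 1 A, (w k m - w k (m + 1)) * ∑ l ∈ range (min k N), v (m + 1 + l)
      = (∑ k ∈ Ico 1 A, w k m - ∑ k ∈ Ico 1 A, w k (m + 1)) * v (m + 1)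
        + ∑ k ∈ Ico 1 A, (w k m - w k (m + 1)) * ∑ l ∈ Ico 1 (min k N), v (m + 1 + l) := by
    rw [← sum_sub_distrib, sum_mul, ← sum_add_distrib]
    refine sum_congr rfl fun k hk => ?_
    have hk1 : 1 ≤ min k N := le_min (mem_Ico.mp hk).1 hN
    rw [range_sum_eq_head_add_Ico v m hk1]; ring
  rw [hsplit] at h
  linarith

/-! ## §2 The heating criterion at one row -/

/-- **LOWER BOUND AT THE PIN.**  Non-increasing excess: `v m ≥ (1 − F m)·v(m+1) + OUTFLOW − HEATING`. [folklore] -/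
theorem sol_step_ge (hR : ∀ u m, R u m = ∑ l ∈ range N, K m l * u (m + 1 + l)) (hK : ∀ m l, K m l = ∑ k ∈ Ico (l + 1) A, w k m)
    (hN : 1 ≤ N) {e v : ℕ → ℝ} (hrec : ∀ m, v m = e m - R v m) {m : ℕ} (hea : e (m + 1) ≤ e m) :
    (1 - ∑ k ∈ Ico 1 A, w k m) * v (m + 1) + ∑ k ∈ Ico 1 A, w k (m + 1) * v (m + 1 + min k N)
      - ∑ k ∈ Ico 1 A, (w k m - w k (m + 1)) * ∑ l ∈ Ico 1 (min k N), v (m + 1 + l) ≤ v m := by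
  have h := sol_step_eq_interior hR hK hN hrec m
  linarith

/-- **THE END AT A ROW IS «HEATING ≤ DROP + PERSISTENCE + OUTFLOW».**  With the equation at `m` and `m+1` in force, `0 ≤ v m` is EQUIVALENT to
`Σ_k (w k m − w k (m+1))·Σ_{l∈[1,κ_k)} v(m+1+l) ≤ (e m − e(m+1)) + (1 − F m)·v(m+1) + Σ_k w k (m+1)·v(m+1+κ_k)`. [folklore] -/
theorem sol_nonneg_iff_heating_le (hR : ∀ u m, R u m = ∑ l ∈ range N, K m l * u (m + 1 + l))
    (hK : ∀ m l, K m l = ∑ k ∈ Ico (l + 1) A, w k m) (hN : 1 ≤ N) {e v : ℕ → ℝ} (hrec : ∀ m, v m = e m - R v m) (m : ℕ) :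
    0 ≤ v m ↔ ∑ k ∈ Ico 1 A, (w k m - w k (m + 1)) * ∑ l ∈ Ico 1 (min k N), v (m + 1 + l)
      ≤ (e m - e (m + 1)) + (1 - ∑ k ∈ Ico 1 A, w k m) * v (m + 1) + ∑ k ∈ Ico 1 A, w k (m + 1) * v (m + 1 + min k N) := by
  have h := sol_step_eq_interior hR hK hN hrec m
  constructor <;> intro h' <;> linarith

/-- **THE HARNACK SOCKET.**  Rates non-increasing in the depth (`w k (m+1) ≤ w k m`), excess non-increasing; `Θ_k` ANY upper bounds for the interior
window sums `Σ_{l∈[1,κ_k)} v(m+1+l)` of the loaded ages; if the decay-weighted bounds fit under persistence + outflow,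
`Σ_k (w k m − w k (m+1))·Θ_k ≤ (1 − F m)·v(m+1) + Σ_k w k (m+1)·v(m+1+κ_k)`, then `0 ≤ v m`.  (In use `Θ_k = (κ_k − 1)·H_k·v(m+1)` with a
Harnack constant `H_k` of the window — README g97 §3.) [folklore] -/
theorem sol_nonneg_of_window_bounds (hR : ∀ u m, R u m = ∑ l ∈ range N, K m l * u (m + 1 + l))
    (hK : ∀ m l, K m l = ∑ k ∈ Ico (l + 1) A, w k m) (hN : 1 ≤ N) (hwmono : ∀ k m, w k (m + 1) ≤ w k m)
    {e v : ℕ → ℝ} (hrec : ∀ m, v m = e m - R v m) {m : ℕ} (hea : e (m + 1) ≤ e m)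
    {Θ : ℕ → ℝ} (hΘ : ∀ k ∈ Ico 1 A, ∑ l ∈ Ico 1 (min k N), v (m + 1 + l) ≤ Θ k)
    (hfit : ∑ k ∈ Ico 1 A, (w k m - w k (m + 1)) * Θ k
      ≤ (1 - ∑ k ∈ Ico 1 A, w k m) * v (m + 1) + ∑ k ∈ Ico 1 A, w k (m + 1) * v (m + 1 + min k N)) :
    0 ≤ v m := by
  have h := sol_step_ge hR hK hN hrec hea
  have hheat : ∑ k ∈ Ico 1 A, (w k m - w k (m + 1)) * ∑ l ∈ Ico 1 (min k N), v (m + 1 + l)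
      ≤ ∑ k ∈ Ico 1 A, (w k m - w k (m + 1)) * Θ k :=
    sum_le_sum fun k hk => mul_le_mul_of_nonneg_left (hΘ k hk) (by linarith [hwmono k m])
  linarith

/-! ## §3 The row induction -/

/-- **THE ROW INDUCTION.**  Zero tail beyond the horizon `N ≥ 1`, the equation at every depth, and AT EVERY ROW the criterion «heating ≤ drop +
persistence + outflow» GIVEN non-negativity strictly below that row — then `0 ≤ v` at every depth.  (The hypothesis is exactly what a Harnack bound
below the pin delivers through `sol_nonneg_of_window_bounds`.) [folklore] -/
theorem sol_nonneg_of_rowwise (hR : ∀ u m, R u m = ∑ l ∈ range N, K m l * u (m + 1 + l))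
    (hK : ∀ m l, K m l = ∑ k ∈ Ico (l + 1) A, w k m) (hN : 1 ≤ N) {e v : ℕ → ℝ} (hrec : ∀ m, v m = e m - R v m)
    (htail : ∀ m, N < m → v m = 0)
    (hrow : ∀ m, (∀ m', m < m' → 0 ≤ v m') →
      ∑ k ∈ Ico 1 A, (w k m - w k (m + 1)) * ∑ l ∈ Ico 1 (min k N), v (m + 1 + l)
        ≤ (e m - e (m + 1)) + (1 - ∑ k ∈ Ico 1 A, w k m) * v (m + 1) + ∑ k ∈ Ico 1 A, w k (m + 1) * v (m + 1 + min k N)) :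
    ∀ m, 0 ≤ v m := by
  suffices hmain : ∀ d m, N < m + d → 0 ≤ v m from fun m => hmain (N + 1) m (by omega)
  intro d
  induction d with
  | zero => intro m hm; rw [htail m (by omega)]
  | succ d ih =>
    intro m hm
    by_cases hNm : N < m
    · rw [htail m hNm]
    have hbelow : ∀ m', m < m' → 0 ≤ v m' := fun m' hm' => ih m' (by omega)
    exact (sol_nonneg_iff_heating_le hR hK hN hrec m).2 (hrow m hbelow)

/-- A non-negative solution lies below its excess (non-negative rates): `v m ≤ e m`. [folklore] -/
theorem sol_le_input (hR : ∀ u m, R u m = ∑ l ∈ range N, K m l * u (m + 1 + l))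
    (hK : ∀ m l, K m l = ∑ k ∈ Ico (l + 1) A, w k m) (hw0 : ∀ k m, 0 ≤ w k m)
    {e v : ℕ → ℝ} (hrec : ∀ m, v m = e m - R v m) (hv0 : ∀ m, 0 ≤ v m) (m : ℕ) : v m ≤ e m := by
  have hR0 : 0 ≤ R v m := by
    rw [read_eq_sum_ages hR hK v m]
    exact sum_nonneg fun k _ => mul_nonneg (hw0 k m) (sum_nonneg fun l _ => hv0 _)
  linarith [hrec m]

/-- **THE END BY THE ROW CRITERION.**  `sol_nonneg_of_rowwise` + `sol_le_input`: under the row criterion the solution lies in `[0, e]` at every depth.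
[folklore] -/
theorem sol_mem_Icc_of_rowwise (hR : ∀ u m, R u m = ∑ l ∈ range N, K m l * u (m + 1 + l))
    (hK : ∀ m l, K m l = ∑ k ∈ Ico (l + 1) A, w k m) (hN : 1 ≤ N) (hw0 : ∀ k m, 0 ≤ w k m)
    {e v : ℕ → ℝ} (hrec : ∀ m, v m = e m - R v m) (htail : ∀ m, N < m → v m = 0)
    (hrow : ∀ m, (∀ m', m < m' → 0 ≤ v m') →
      ∑ k ∈ Ico 1 A, (w k m - w k (m + 1)) * ∑ l ∈ Ico 1 (min k N), v (m + 1 + l)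
        ≤ (e m - e (m + 1)) + (1 - ∑ k ∈ Ico 1 A, w k m) * v (m + 1) + ∑ k ∈ Ico 1 A, w k (m + 1) * v (m + 1 + min k N)) :
    ∀ m, 0 ≤ v m ∧ v m ≤ e m := fun m =>
  ⟨sol_nonneg_of_rowwise hR hK hN hrec htail hrow m,
    sol_le_input hR hK hw0 hrec (sol_nonneg_of_rowwise hR hK hN hrec htail hrow) m⟩

end Summit.QuantumFields.BalabanUV.Beta.EriceRemainderEnclosureHistoryAutonomyComparisonAgeCompositionHeatingCriterion

end
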